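import Summits.Ventures.LatticeQCDFlow.Scaling.ParallelTemperingSwapKernelBalance
import Summits.Ventures.LatticeQCDFlow.Scaling.SimulatedTemperingWithinLevel
import Summits.Ventures.LatticeQCDFlow.Scaling.SimulatedTemperingComposition
import Summits.Ventures.LatticeQCDFlow.Scaling.TemperingLevelTauInt

/-!
HONEST FRAMING: exact (Metropolis-corrected) sampling algorithms for lattice gauge theory; figures
of merit are autocorrelation/cost numbers at stated couplings and volumes; no continuum-physics
claim.

# ParallelTemperingAlgorithm — THE REPLICA-EXCHANGE SAMPLER ITSELF (THE CONSTRUCTED SWAP KERNEL FOLLOWED BY,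
# OR MIXED WITH, ANY EXACT WITHIN-REPLICA DYNAMICS) SATISFIES (i)–(iii), SO ITS TAGGED REPLICA IS DIFFUSIVE:
# `ρ_τ(1) ≥ 1 − 6ā_K/(K(K+2))`, REPLICA-NUMBER-FREE `≥ 1 − 48/(e·m·(b−a)²)`, `τ_int ≥ e·m·(b−a)²/48 − ½` IN
# RANDOM SCAN WITH REVERSIBLE UPDATES; WILSON, EVERY COMPACT GAUGE GROUP, EVERY COUPLING; PTBC (lean-2 GEN-14, ours)

Venture-side (OURS).  Cell `lqcd-flow` (pub-lqcd), unit `pub-lqcd-lean-2-g14`, 2026-08-24.  GEN-13's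
replica-exchange laws (`Scaling/ParallelTemperingDiffusive`, `Scaling/TemperingLevelTauInt`) quantify over all
Markov kernels on the tagged space with (i) `ptTaggedTarget` invariant, (ii) nearest-neighbour tag moves, (iii)
tag-move probability `≤ ptSwapRatio`.  GEN-14 CONSTRUCTED the swap kernel `S = ptSwapKernel hXm β K`
(`Scaling/ParallelTemperingSwapKernel{,Balance}`: Markov, (ii), (iii), DETAILED BALANCE).  This file ASSEMBLES
the sampler: `M ∘ₖ S` ("attempt a swap, then update every replica at its own coupling") for ANY Markov `M` on the
tagged space that preserves the tag and leaves the tagged target invariant (the within-replica dynamics: it does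
not touch the tag and is exact replica by replica), and the random-scan sampler `t·S + (1−t)·M`
(`mixtureKernel`, `Scaling/SimulatedTemperingWithinLevel`); both satisfy (i)–(iii), hence every GEN-13 law —
theorems about samplers whose swap move is the NAMED constructed kernel.

## What is proved (`μ` probability, `X` bounded measurable, `K ≥ 1`; `M` Markov on `Fin (K+1) × (Fin (K+1) → Ω)`
## with `M y {tag ≠ tag y} = 0` and `ptTaggedTarget X μ β K` invariant; `ā_K = (2/(K+1))·Σ_j swapAcc(β_j, β_{j+1})`)

* §1 `M ∘ₖ S`: `ptScan_invariant`, `ptScan_nearestNeighbour`, `ptScan_real_moves_le` ((i)–(iii));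
  **`ptScan_level_lagOneAutocorr_ge`** (`1 − 6ā_K/(K(K+2)) ≤ ρ_τ(1)`);
  **`ptScan_level_lagOneAutocorr_ge_kfree`** (uniform ladder, floor `m`: `1 − 48/(e·m·(b−a)²) ≤ ρ_τ(1)` for
  every `K`).
* §2 `t·S + (1−t)·M`: `ptMix_invariant`, `ptMix_nearestNeighbour`, `ptMix_real_moves_le`, `ptMix_isReversible`
  (`M` reversible); **`ptMix_level_lagOneAutocorr_ge_kfree`**; **`ptMix_level_tauInt_ge_kfree`** —
  `e·m·(b−a)²/48 − ½ ≤ τ_int(tag)` for every `K ≥ 1`, every `t` (reversible `M`; summable autocorrelations,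
  `ρ(1) < 1`).
* §3 **`wilson_ptScan_level_lagOneAutocorr_ge_allCouplings`** (every compact `G`, unitary continuous `ρ`, `d ≥ 2`,
  `L ≥ 2`, `Var_Haar(Re tr ρ) > 0`, `−B ≤ a < b ≤ B`): replica exchange of the Wilson measure with the
  constructed swap move and ANY exact within-replica gauge updates has
  `1 − 48·e^{B·2NK'(1+4K')}/(e·⌊L/2⌋^d·Var_Haar(Re tr ρ)·(b−a)²) ≤ ρ_τ(1)`;
  **`defect_ptScan_level_lagOneAutocorr_ge`** — PTBC (tempering in the boundary condition over a plaquette set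
  `D`, lean-1's defect floor): `1 − 48/(e·m_D·Δc²) ≤ ρ_τ(1)`, `m_D = e^{−8N(d−1)B}(#D/(8d(d−1)+1))Var_Haar(Re tr ρ)`.

NOT CLAIMED: a construction of the within-replica product update `M` (abstract: any tag-preserving exact
kernel; the product of `K+1` independent exact updates is one, not typed as a `Kernel` here); half-sweeps;
irreducibility; summability provisos; any measured number.  Literature grade (cell rule): TEXTBOOK ALGORITHM
(Hukushima–Nemoto 1996; PTBC: Hasenbusch, Phys. Rev. D 96 (2017) 054504; Bonanno–Bonati–D'Elia, JHEP 03 (2021)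
111) + KNOWN MECHANISM (diffusive replica motion), NEW TYPING; nothing cited as a fact; no new bib keys.
-/

noncomputable section

open MeasureTheory ProbabilityTheory Set Filter Finset
open Literature.MathematicalPhysics.QuantumFieldTheory
open Literature.MathematicalPhysics.QuantumFieldTheory.Luscher2010
open Summit.Ventures.LatticeQCDFlow.Scoring
open Summit.Ventures.LatticeQCDFlow.TrivializingMaps
open scoped ENNReal

namespace Summit.Ventures.LatticeQCDFlow.Scaling

/-! ## §1 Swap, then any exact within-replica dynamics -/

section Scan

variable {Ω : Type*} [MeasurableSpace Ω] {X : Ω → ℝ} {μ : Measure Ω} [IsProbabilityMeasure μ]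
  {β : ℕ → ℝ} {K : ℕ}

/-- (i) for `M ∘ₖ S`: the tagged target is invariant (`K ≥ 1`). [ours] -/
theorem ptScan_invariant [NeZero K] (hXm : Measurable X) (hXb : ∃ C, ∀ x, |X x| ≤ C)
    (M : Kernel (Fin (K + 1) × (Fin (K + 1) → Ω)) (Fin (K + 1) × (Fin (K + 1) → Ω)))
    (hMinv : Kernel.Invariant M (ptTaggedTarget X μ β K)) :
    Kernel.Invariant (M ∘ₖ ptSwapKernel hXm β K) (ptTaggedTarget X μ β K) :=
  hMinv.comp (invariant_ptSwapKernel hXm hXb)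

omit [IsProbabilityMeasure μ] in
/-- (ii) for `M ∘ₖ S`: the tag moves by at most one level. [ours] -/
theorem ptScan_nearestNeighbour (hXm : Measurable X)
    (M : Kernel (Fin (K + 1) × (Fin (K + 1) → Ω)) (Fin (K + 1) × (Fin (K + 1) → Ω))) [IsMarkovKernel M]
    (hM : ∀ y, M y {y' | ((y'.1 : Fin (K + 1)) : ℕ) ≠ ((y.1 : Fin (K + 1)) : ℕ)} = 0)
    (z : Fin (K + 1) × (Fin (K + 1) → Ω)) :
    ∀ᵐ y ∂((M ∘ₖ ptSwapKernel hXm β K) z), |(((y.1 : Fin (K + 1)) : ℕ) : ℝ) - ((z.1 : Fin (K + 1)) : ℕ)| ≤ 1 :=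
  comp_nearestNeighbour (M := M) (κ₁ := ptSwapKernel hXm β K) measurable_ptLevel hM
    (ptSwapKernel_nearestNeighbour hXm) z

omit [IsProbabilityMeasure μ] in
/-- (iii) for `M ∘ₖ S`: the tag-move probability is that of the swap kernel, `≤ ptSwapRatio`. [ours] -/
theorem ptScan_real_moves_le (hXm : Measurable X) (hK : 1 ≤ K)
    (M : Kernel (Fin (K + 1) × (Fin (K + 1) → Ω)) (Fin (K + 1) × (Fin (K + 1) → Ω))) [IsMarkovKernel M]
    (hM : ∀ y, M y {y' | ((y'.1 : Fin (K + 1)) : ℕ) ≠ ((y.1 : Fin (K + 1)) : ℕ)} = 0)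
    (z : Fin (K + 1) × (Fin (K + 1) → Ω)) :
    ((M ∘ₖ ptSwapKernel hXm β K) z).real {y | ((y.1 : Fin (K + 1)) : ℕ) ≠ ((z.1 : Fin (K + 1)) : ℕ)} ≤
      ptSwapRatio X β K z := by
  have e : {y : Fin (K + 1) × (Fin (K + 1) → Ω) | ((y.1 : Fin (K + 1)) : ℕ) ≠ ((z.1 : Fin (K + 1)) : ℕ)} =
      (fun y : Fin (K + 1) × (Fin (K + 1) → Ω) => ((y.1 : Fin (K + 1)) : ℕ)) ⁻¹'
        {n : ℕ | n ≠ ((z.1 : Fin (K + 1)) : ℕ)} := by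
    ext y; simp
  rw [e, comp_real_levelSet (M := M) (κ₁ := ptSwapKernel hXm β K) measurable_ptLevel hM, ← e]
  exact ptSwapKernel_real_moves_le hXm hK z

/-- **THE TAGGED REPLICA OF THE REPLICA-EXCHANGE SAMPLER IS DIFFUSIVE.**  `μ` a probability measure, `X` bounded
measurable, `K ≥ 1`, `M` any tag-preserving Markov kernel leaving the tagged target invariant (exact within-replica
dynamics).  The sampler "constructed swap move, then `M`" has `1 − 6ā_K/(K(K+2)) ≤ ρ_τ(1)`,
`ā_K = (2/(K+1))·Σ_{j<K} swapAcc X μ β_j β_{j+1}`. [ours] -/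
theorem ptScan_level_lagOneAutocorr_ge (hXm : Measurable X) (hXb : ∃ C, ∀ x, |X x| ≤ C) (hK : 1 ≤ K)
    (M : Kernel (Fin (K + 1) × (Fin (K + 1) → Ω)) (Fin (K + 1) × (Fin (K + 1) → Ω))) [IsMarkovKernel M]
    (hMinv : Kernel.Invariant M (ptTaggedTarget X μ β K))
    (hM : ∀ y, M y {y' | ((y'.1 : Fin (K + 1)) : ℕ) ≠ ((y.1 : Fin (K + 1)) : ℕ)} = 0) :
    1 - 6 * (2 / (K + 1) * ∑ j : Fin K, swapAcc X μ (β (j : ℕ)) (β ((j : ℕ) + 1))) / (K * (K + 2)) ≤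
      (autocov (M ∘ₖ ptSwapKernel hXm β K) (ptTaggedTarget X μ β K)
          (fun z => (((z.1 : Fin (K + 1)) : ℕ) : ℝ)) 1 - ((K : ℝ) / 2) ^ 2) / (K * (K + 2) / 12) := by
  haveI : NeZero K := ⟨by omega⟩
  exact pt_level_lagOneAutocorr_ge hXm hXb hK _ (ptScan_invariant hXm hXb M hMinv)
    (ptScan_nearestNeighbour hXm M hM) (ptScan_real_moves_le hXm hK M hM)

/-- **REPLICA-NUMBER-FREE, for the sampler**: uniform ladder `β_k = a + k(b−a)/K`, `a < b`, variance floor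
`0 < m ≤ Var_{μ_u}(X)` on `[a, b]`: `1 − 48/(e·m·(b−a)²) ≤ ρ_τ(1)` for `M ∘ₖ ptSwapKernel`, every `K ≥ 1`. [ours] -/
theorem ptScan_level_lagOneAutocorr_ge_kfree (hXm : Measurable X) (hXb : ∃ C, ∀ x, |X x| ≤ C) {a b m : ℝ}
    (hab : a < b) (hm0 : 0 < m) (hm : ∀ u ∈ Icc a b, m ≤ variance X (μ.tilted fun x => u * X x)) (hK : 1 ≤ K)
    (M : Kernel (Fin (K + 1) × (Fin (K + 1) → Ω)) (Fin (K + 1) × (Fin (K + 1) → Ω))) [IsMarkovKernel M]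
    (hMinv : Kernel.Invariant M (ptTaggedTarget X μ (fun k => a + k * ((b - a) / K)) K))
    (hM : ∀ y, M y {y' | ((y'.1 : Fin (K + 1)) : ℕ) ≠ ((y.1 : Fin (K + 1)) : ℕ)} = 0) :
    1 - 48 / (Real.exp 1 * m * (b - a) ^ 2) ≤
      (autocov (M ∘ₖ ptSwapKernel hXm (fun k => a + k * ((b - a) / K)) K)
          (ptTaggedTarget X μ (fun k => a + k * ((b - a) / K)) K)
          (fun z => (((z.1 : Fin (K + 1)) : ℕ) : ℝ)) 1 - ((K : ℝ) / 2) ^ 2) / (K * (K + 2) / 12) := by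
  haveI : NeZero K := ⟨by omega⟩
  exact pt_level_lagOneAutocorr_ge_kfree hXm hXb hab hm0 hm hK _
    (ptScan_invariant (β := fun k => a + k * ((b - a) / K)) hXm hXb M hMinv)
    (ptScan_nearestNeighbour hXm M hM) (ptScan_real_moves_le hXm hK M hM)

end Scan

/-! ## §2 Random scan: with probability `t` attempt a swap, else update the replicas -/

section Mix

variable {Ω : Type*} [MeasurableSpace Ω] {X : Ω → ℝ} {μ : Measure Ω} [IsProbabilityMeasure μ]
  {β : ℕ → ℝ} {K : ℕ}

/-- (i) for `t·S + (1−t)·M`. [ours] -/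
theorem ptMix_invariant [NeZero K] (hXm : Measurable X) (hXb : ∃ C, ∀ x, |X x| ≤ C) (t : unitInterval)
    (M : Kernel (Fin (K + 1) × (Fin (K + 1) → Ω)) (Fin (K + 1) × (Fin (K + 1) → Ω)))
    (hMinv : Kernel.Invariant M (ptTaggedTarget X μ β K)) :
    Kernel.Invariant (mixtureKernel t (ptSwapKernel hXm β K) M) (ptTaggedTarget X μ β K) :=
  invariant_mixtureKernel t (invariant_ptSwapKernel hXm hXb) hMinv

omit [IsProbabilityMeasure μ] in
/-- (ii) for `t·S + (1−t)·M`. [ours] -/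
theorem ptMix_nearestNeighbour (hXm : Measurable X) (t : unitInterval)
    (M : Kernel (Fin (K + 1) × (Fin (K + 1) → Ω)) (Fin (K + 1) × (Fin (K + 1) → Ω)))
    (hM : ∀ y, M y {y' | ((y'.1 : Fin (K + 1)) : ℕ) ≠ ((y.1 : Fin (K + 1)) : ℕ)} = 0)
    (z : Fin (K + 1) × (Fin (K + 1) → Ω)) :
    ∀ᵐ y ∂(mixtureKernel t (ptSwapKernel hXm β K) M z),
      |(((y.1 : Fin (K + 1)) : ℕ) : ℝ) - ((z.1 : Fin (K + 1)) : ℕ)| ≤ 1 := by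
  rw [ae_iff]
  refine mixtureKernel_null t _ _ z (ae_iff.1 (ptSwapKernel_nearestNeighbour hXm z)) ?_
  refine measure_mono_null (fun y hy => ?_) (hM z)
  intro h
  apply hy
  show |(((y.1 : Fin (K + 1)) : ℕ) : ℝ) - ((z.1 : Fin (K + 1)) : ℕ)| ≤ 1
  rw [h, sub_self, abs_zero]; exact zero_le_one

omit [IsProbabilityMeasure μ] in
/-- (iii) for `t·S + (1−t)·M`: the tag-move probability is `t` times that of the swap kernel. [ours] -/
theorem ptMix_real_moves_le (hXm : Measurable X) (hK : 1 ≤ K) (t : unitInterval)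
    (M : Kernel (Fin (K + 1) × (Fin (K + 1) → Ω)) (Fin (K + 1) × (Fin (K + 1) → Ω))) [IsMarkovKernel M]
    (hM : ∀ y, M y {y' | ((y'.1 : Fin (K + 1)) : ℕ) ≠ ((y.1 : Fin (K + 1)) : ℕ)} = 0)
    (z : Fin (K + 1) × (Fin (K + 1) → Ω)) :
    (mixtureKernel t (ptSwapKernel hXm β K) M z).real {y | ((y.1 : Fin (K + 1)) : ℕ) ≠ ((z.1 : Fin (K + 1)) : ℕ)} ≤
      ptSwapRatio X β K z := by
  haveI : NeZero K := ⟨by omega⟩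
  rw [mixtureKernel_real]
  have hW : (M z).real {y | ((y.1 : Fin (K + 1)) : ℕ) ≠ ((z.1 : Fin (K + 1)) : ℕ)} = 0 := by
    rw [measureReal_def, hM z, ENNReal.toReal_zero]
  rw [hW, mul_zero, add_zero]
  calc (t : ℝ) * (ptSwapKernel hXm β K z).real {y | ((y.1 : Fin (K + 1)) : ℕ) ≠ ((z.1 : Fin (K + 1)) : ℕ)}
      ≤ 1 * (ptSwapKernel hXm β K z).real {y | ((y.1 : Fin (K + 1)) : ℕ) ≠ ((z.1 : Fin (K + 1)) : ℕ)} :=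
        mul_le_mul_of_nonneg_right t.2.2 measureReal_nonneg
    _ ≤ ptSwapRatio X β K z := by rw [one_mul]; exact ptSwapKernel_real_moves_le hXm hK z

/-- **Detailed balance of the random-scan sampler**: `M` reversible ⇒ `t·S + (1−t)·M` reversible. [ours] -/
theorem ptMix_isReversible (hXm : Measurable X) (hXb : ∃ C, ∀ x, |X x| ≤ C) (t : unitInterval)
    (M : Kernel (Fin (K + 1) × (Fin (K + 1) → Ω)) (Fin (K + 1) × (Fin (K + 1) → Ω)))
    (hMrev : Kernel.IsReversible M (ptTaggedTarget X μ β K)) :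
    Kernel.IsReversible (mixtureKernel t (ptSwapKernel hXm β K) M) (ptTaggedTarget X μ β K) :=
  isReversible_mixtureKernel t (isReversible_ptSwapKernel hXm hXb) hMrev

/-- **REPLICA-NUMBER-FREE LAW, random scan**: `1 − 48/(e·m·(b−a)²) ≤ ρ_τ(1)` for `t·ptSwapKernel + (1−t)·M`,
every `K ≥ 1`, every `t`, every tag-preserving exact `M`. [ours] -/
theorem ptMix_level_lagOneAutocorr_ge_kfree (hXm : Measurable X) (hXb : ∃ C, ∀ x, |X x| ≤ C) {a b m : ℝ}
    (hab : a < b) (hm0 : 0 < m) (hm : ∀ u ∈ Icc a b, m ≤ variance X (μ.tilted fun x => u * X x)) (hK : 1 ≤ K)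
    (t : unitInterval) (M : Kernel (Fin (K + 1) × (Fin (K + 1) → Ω)) (Fin (K + 1) × (Fin (K + 1) → Ω)))
    [IsMarkovKernel M] (hMinv : Kernel.Invariant M (ptTaggedTarget X μ (fun k => a + k * ((b - a) / K)) K))
    (hM : ∀ y, M y {y' | ((y'.1 : Fin (K + 1)) : ℕ) ≠ ((y.1 : Fin (K + 1)) : ℕ)} = 0) :
    1 - 48 / (Real.exp 1 * m * (b - a) ^ 2) ≤
      (autocov (mixtureKernel t (ptSwapKernel hXm (fun k => a + k * ((b - a) / K)) K) M)
          (ptTaggedTarget X μ (fun k => a + k * ((b - a) / K)) K)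
          (fun z => (((z.1 : Fin (K + 1)) : ℕ) : ℝ)) 1 - ((K : ℝ) / 2) ^ 2) / (K * (K + 2) / 12) := by
  haveI : NeZero K := ⟨by omega⟩
  exact pt_level_lagOneAutocorr_ge_kfree hXm hXb hab hm0 hm hK _
    (ptMix_invariant (β := fun k => a + k * ((b - a) / K)) hXm hXb t M hMinv)
    (ptMix_nearestNeighbour hXm t M hM) (ptMix_real_moves_le hXm hK t M hM)

/-- **`τ_int` OF THE TAGGED REPLICA, REPLICA-NUMBER-FREE (random scan, reversible within-replica dynamics)**:
uniform ladder on `[a,b]`, floor `0 < m ≤ Var_{μ_u}(X)`, `M` tag-preserving and REVERSIBLE for the tagged target,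
summable tag autocorrelations with `ρ(1) < 1`: `e·m·(b−a)²/48 − ½ ≤ τ_int(tag)` for every `K ≥ 1` and every `t`.
[ours] -/
theorem ptMix_level_tauInt_ge_kfree (hXm : Measurable X) (hXb : ∃ C, ∀ x, |X x| ≤ C) {a b m : ℝ} (hab : a < b)
    (hm0 : 0 < m) (hm : ∀ u ∈ Icc a b, m ≤ variance X (μ.tilted fun x => u * X x)) (hK : 1 ≤ K)
    (t : unitInterval) (M : Kernel (Fin (K + 1) × (Fin (K + 1) → Ω)) (Fin (K + 1) × (Fin (K + 1) → Ω)))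
    [IsMarkovKernel M] (hMrev : Kernel.IsReversible M (ptTaggedTarget X μ (fun k => a + k * ((b - a) / K)) K))
    (hM : ∀ y, M y {y' | ((y'.1 : Fin (K + 1)) : ℕ) ≠ ((y.1 : Fin (K + 1)) : ℕ)} = 0)
    (hs : Summable fun n =>
      autocov (mixtureKernel t (ptSwapKernel hXm (fun k => a + k * ((b - a) / K)) K) M)
        (ptTaggedTarget X μ (fun k => a + k * ((b - a) / K)) K) (fun z => (((z.1 : Fin (K + 1)) : ℕ) : ℝ) - K / 2)
        (n + 1) /
      autocov (mixtureKernel t (ptSwapKernel hXm (fun k => a + k * ((b - a) / K)) K) M)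
        (ptTaggedTarget X μ (fun k => a + k * ((b - a) / K)) K) (fun z => (((z.1 : Fin (K + 1)) : ℕ) : ℝ) - K / 2) 0)
    (hρ : autocov (mixtureKernel t (ptSwapKernel hXm (fun k => a + k * ((b - a) / K)) K) M)
        (ptTaggedTarget X μ (fun k => a + k * ((b - a) / K)) K) (fun z => (((z.1 : Fin (K + 1)) : ℕ) : ℝ) - K / 2) 1 /
      autocov (mixtureKernel t (ptSwapKernel hXm (fun k => a + k * ((b - a) / K)) K) M)
        (ptTaggedTarget X μ (fun k => a + k * ((b - a) / K)) K) (fun z => (((z.1 : Fin (K + 1)) : ℕ) : ℝ) - K / 2) 0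
        < 1) :
    Real.exp 1 * m * (b - a) ^ 2 / 48 - 1 / 2 ≤
      tauInt (fun n =>
        autocov (mixtureKernel t (ptSwapKernel hXm (fun k => a + k * ((b - a) / K)) K) M)
          (ptTaggedTarget X μ (fun k => a + k * ((b - a) / K)) K) (fun z => (((z.1 : Fin (K + 1)) : ℕ) : ℝ) - K / 2)
          n /
        autocov (mixtureKernel t (ptSwapKernel hXm (fun k => a + k * ((b - a) / K)) K) M)
          (ptTaggedTarget X μ (fun k => a + k * ((b - a) / K)) K) (fun z => (((z.1 : Fin (K + 1)) : ℕ) : ℝ) - K / 2)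
          0) := by
  haveI : NeZero K := ⟨by omega⟩
  exact pt_level_tauInt_ge_kfree hXm hXb hab hm0 hm hK _ (ptMix_isReversible hXm hXb t M hMrev)
    (ptMix_invariant (β := fun k => a + k * ((b - a) / K)) hXm hXb t M hMrev.invariant)
    (ptMix_nearestNeighbour hXm t M hM) (ptMix_real_moves_le hXm hK t M hM) hs hρ

end Mix

/-! ## §3 The Wilson coupling family and PTBC: every compact gauge group, every coupling -/

section Wilson

variable {d L N : ℕ} [NeZero L] {G : Type*} [Group G] [TopologicalSpace G] [IsTopologicalGroup G]
  [CompactSpace G] [MeasurableSpace G] [BorelSpace G] [SecondCountableTopology G]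
  (ρ : G →* Matrix (Fin N) (Fin N) ℂ)

/-- **REPLICA EXCHANGE OF THE WILSON MEASURE IN THE COUPLING IS DIFFUSIVE — FOR THE SAMPLER WITH THE CONSTRUCTED
SWAP MOVE.**  Unitary continuous `ρ`, `d ≥ 2`, `L ≥ 2`, `Var_Haar(Re tr ρ) > 0`, `−B ≤ a < b ≤ B`, `K ≥ 1`; `M` ANY
tag-preserving Markov kernel on the tagged replica space of gauge fields leaving the tagged product of Wilson
measures at the ladder couplings invariant (independent heat-bath / HMC / flow updates of the replicas).  Then
`1 − 48·e^{B·2NK'(1+4K')}/(e·⌊L/2⌋^d·Var_Haar(Re tr ρ)·(b−a)²) ≤ ρ_τ(1)` for `M ∘ₖ ptSwapKernel`, `K' = (d+1)d²`.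
[ours] -/
theorem wilson_ptScan_level_lagOneAutocorr_ge_allCouplings (hd : 2 ≤ d) (hL : 2 ≤ L) (hρ : Continuous ρ)
    (hρu : ∀ g, ρ g ∈ Matrix.unitaryGroup (Fin N) ℂ)
    (hv : 0 < variance (fun g => (ρ g).trace.re) (haarProbability G)) {a b B : ℝ} (ha : -B ≤ a)
    (hab : a < b) (hb : b ≤ B) {K : ℕ} (hK : 1 ≤ K)
    (M : Kernel (Fin (K + 1) × (Fin (K + 1) → GaugeConfig d L G)) (Fin (K + 1) × (Fin (K + 1) → GaugeConfig d L G)))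
    [IsMarkovKernel M]
    (hMinv : Kernel.Invariant M (ptTaggedTarget (fun U => -wilsonAction ρ U) (trivialMeasure G d L)
      (fun k => a + k * ((b - a) / K)) K))
    (hM : ∀ y, M y {y' | ((y'.1 : Fin (K + 1)) : ℕ) ≠ ((y.1 : Fin (K + 1)) : ℕ)} = 0) :
    1 - 48 * Real.exp (B * (2 * N * ((d + 1) * d ^ 2 : ℕ) * (1 + 4 * ((d + 1) * d ^ 2 : ℕ)))) /
        (Real.exp 1 * (((L / 2) ^ d : ℕ) * variance (fun g => (ρ g).trace.re) (haarProbability G)) *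
          (b - a) ^ 2) ≤
      (autocov (M ∘ₖ ptSwapKernel (measurable_neg_wilsonAction ρ hρ) (fun k => a + k * ((b - a) / K)) K)
          (ptTaggedTarget (fun U => -wilsonAction ρ U) (trivialMeasure G d L) (fun k => a + k * ((b - a) / K)) K)
          (fun z => (((z.1 : Fin (K + 1)) : ℕ) : ℝ)) 1 - ((K : ℝ) / 2) ^ 2) / (K * (K + 2) / 12) := by
  haveI : IsProbabilityMeasure (trivialMeasure G d L) := trivialMeasure_isProbabilityMeasure
  haveI : NeZero K := ⟨by omega⟩
  exact wilson_pt_level_lagOneAutocorr_ge_allCouplings ρ hd hL hρ hρu hv ha hab hb hK _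
    (ptScan_invariant (β := fun k => a + k * ((b - a) / K)) (measurable_neg_wilsonAction ρ hρ)
      (neg_wilsonAction_bounded ρ hρ) M hMinv)
    (ptScan_nearestNeighbour (measurable_neg_wilsonAction ρ hρ) M hM)
    (ptScan_real_moves_le (measurable_neg_wilsonAction ρ hρ) hK M hM)

/-- **PTBC — PARALLEL TEMPERING IN THE BOUNDARY CONDITION — WITH THE CONSTRUCTED SWAP MOVE IS DIFFUSIVE**
(any compact `G`, continuous `ρ` with `Var_Haar(Re tr ρ) > 0`, `L ≥ 2`, a non-empty plaquette set `D` whose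
coupling `c` is tempered over the uniform ladder from `a` to `b` inside `[−B, B]` at bulk coupling `|β| ≤ B`,
`K ≥ 1`; `M` ANY tag-preserving Markov kernel leaving the tagged product of the defect measures invariant):
`1 − 48/(e·m_D·(b−a)²) ≤ ρ_τ(1)`, `m_D = e^{−8N(d−1)B}·(#D/(8d(d−1)+1))·Var_Haar(Re tr ρ)` (lean-1's defect
specific-heat floor) — `Ω(#D·Δc²)` swap rounds per decorrelation of a replica's boundary condition. [ours] -/
theorem defect_ptScan_level_lagOneAutocorr_ge (hL : 2 ≤ L) (hρ : Continuous ρ)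
    (hv : 0 < variance (fun g : G => (ρ g).trace.re) (haarProbability G)) (D : Finset (Plaquette d L))
    (hD : 0 < D.card) {β B a b : ℝ} (hβ : |β| ≤ B) (ha : -B ≤ a) (hab : a < b) (hb : b ≤ B)
    {K : ℕ} (hK : 1 ≤ K)
    (M : Kernel (Fin (K + 1) × (Fin (K + 1) → GaugeConfig d L G)) (Fin (K + 1) × (Fin (K + 1) → GaugeConfig d L G)))
    [IsMarkovKernel M]
    (hMinv : Kernel.Invariant M (ptTaggedTarget
      (fun U : GaugeConfig d L G => -(∑ p ∈ D, ((N : ℝ) - (ρ (plaquetteHolonomy U p.1 p.2.1.1 p.2.1.2)).trace.re)))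
      ((Measure.pi fun _ : Edge d L => haarProbability G).tilted fun U =>
        -(β * ∑ p ∈ Dᶜ, ((N : ℝ) - (ρ (plaquetteHolonomy U p.1 p.2.1.1 p.2.1.2)).trace.re)))
      (fun k => a + k * ((b - a) / K)) K))
    (hM : ∀ y, M y {y' | ((y'.1 : Fin (K + 1)) : ℕ) ≠ ((y.1 : Fin (K + 1)) : ℕ)} = 0) :
    1 - 48 / (Real.exp 1 * (Real.exp (-(8 * N * ((d - 1 : ℕ) : ℝ) * B)) *
        ((D.card : ℝ) / ((8 * d * (d - 1) + 1 : ℕ) : ℝ)) *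
          variance (fun g : G => (ρ g).trace.re) (haarProbability G)) * (b - a) ^ 2) ≤
      (autocov (M ∘ₖ ptSwapKernel (measurable_neg_defectSum ρ hρ D) (fun k => a + k * ((b - a) / K)) K)
          (ptTaggedTarget
            (fun U : GaugeConfig d L G =>
              -(∑ p ∈ D, ((N : ℝ) - (ρ (plaquetteHolonomy U p.1 p.2.1.1 p.2.1.2)).trace.re)))
            ((Measure.pi fun _ : Edge d L => haarProbability G).tilted fun U =>
              -(β * ∑ p ∈ Dᶜ, ((N : ℝ) - (ρ (plaquetteHolonomy U p.1 p.2.1.1 p.2.1.2)).trace.re)))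
            (fun k => a + k * ((b - a) / K)) K)
          (fun z => (((z.1 : Fin (K + 1)) : ℕ) : ℝ)) 1 - ((K : ℝ) / 2) ^ 2) / (K * (K + 2) / 12) := by
  haveI := isProbabilityMeasure_defectBase (d := d) (L := L) ρ hρ β D
  haveI : NeZero K := ⟨by omega⟩
  exact defect_pt_level_lagOneAutocorr_ge ρ hL hρ hv D hD hβ ha hab hb hK _
    (ptScan_invariant (β := fun k => a + k * ((b - a) / K)) (measurable_neg_defectSum ρ hρ D)
      (neg_defectSum_bounded ρ hρ D) M hMinv)
    (ptScan_nearestNeighbour (measurable_neg_defectSum ρ hρ D) M hM)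
    (ptScan_real_moves_le (measurable_neg_defectSum ρ hρ D) hK M hM)

end Wilson

end Summit.Ventures.LatticeQCDFlow.Scaling

end
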